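import Literature.AlgebraicTopology.SingularHomology.PinchWedges
import Literature.AlgebraicTopology.SingularHomology.MayerVietorisPullbackInjective
import Literature.AlgebraicTopology.SingularHomology.CohomologyDisjointOpenCover
import Literature.AlgebraicTopology.SingularHomology.CohomologyOfPoint
import HarnessLib

/-!
# Pinching finitely many points of a manifold, III: the pinch map is injective on `H²`

Sequel to `PinchDiscs`, `PinchWedges`. For a quotient map `q : N → K` from a Hausdorff space
charted on a proper real normed space, injective except on a finite set `F`, and any commutative
coefficient ring `R`:

* `singularCohomology_map_injective_two_of_pinch` — **`q* : H²(K; R) → H²(N; R)` is injective.**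
  Cover `K` by `A = q(outer)` (`outer` = complement of the closed half-discs of the points of `F`,
  on which `q` is a homeomorphism onto its image) and `B = q(discs)` (the disjoint union of the
  contractible pinched wedges, `H²(↥B) = 0`, whose preimage is the disjoint union of the
  contractible discs, `H¹ = 0`); the Mayer–Vietoris four-lemma for pull-backs
  (`subsetCochains.singularCohomology_map_injective_of_cover`, Hatcher §3.1 p. 204 with the
  naturality of `δ`) gives the injectivity on `H²`.

For the complex points of an irreducible curve `Z ⊆ X` and its normalisation `Z̃ → Z` this is the
injectivity of `H²(Z(ℂ)) → H²(Z̃(ℂ))` — the degree-`2` case of Deligne's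
`Ker(i*) = Ker(q*)` (Hodge III, Prop. 8.2.7), which in this degree needs no weights.
Everything is proved; no named facts.

## References

* [HatcherAT2002] A. Hatcher, Algebraic Topology, CUP 2002, §3.1 pp. 201–204.
* [DeligneHodgeIII1974] P. Deligne, Théorie de Hodge III, Publ. Math. IHÉS 44 (1974), Prop. 8.2.7.
-/

noncomputable section

open Set Filter Topology unitInterval

namespace Literature.AlgebraicTopology.SingularHomology

namespace Pinch

/-! ### The pinch map is injective on `H²` -/

section CoverLemmas

variable {E : Type*} [NormedAddCommGroup E]
  {N : Type*} [TopologicalSpace N] [ChartedSpace E N] {K : Type*} {q : N → K} {F : Set N}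
  (hinj : ∀ ⦃a b : N⦄, q a = q b → a ≠ b → a ∈ F ∧ b ∈ F) (D : DiscSystem E F)

/-- All the discs of the points of `F`. [folklore] -/
def discs (D : DiscSystem E F) : Set N := ⋃ (n : N) (_ : n ∈ F), D.disc n

/-- Membership in the union of the discs. [folklore] -/
theorem mem_discs_iff {x : N} : x ∈ discs D ↔ ∃ n ∈ F, x ∈ D.disc n := by
  simp only [discs, mem_iUnion, exists_prop]

/-- The union of the discs is open. [folklore] -/
theorem isOpen_discs : IsOpen (discs D) :=
  isOpen_iUnion fun n ↦ isOpen_iUnion fun _ ↦ isOpen_chartDisc n _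

include hinj in
/-- The discs are saturated: `q⁻¹(q(discs)) = discs`. [folklore] -/
theorem preimage_image_discs : q ⁻¹' (q '' discs D) = discs D := by
  refine Subset.antisymm (fun x hx ↦ ?_) (subset_preimage_image q _)
  obtain ⟨y, hy, hxy⟩ := hx
  obtain ⟨n, hn, hyn⟩ := (mem_discs_iff D).1 hy
  by_cases hxy' : y = x
  · exact hxy' ▸ hy
  · obtain ⟨-, hxF⟩ := hinj hxy hxy'
    exact (mem_discs_iff D).2 ⟨x, hxF, D.mem_disc_self hxF⟩

/-- `q(discs)` is the union of the pinched wedges over the points of `q(F)`. [folklore] -/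
theorem image_discs_eq : q '' discs D = ⋃ (y : K) (_ : y ∈ q '' F), q '' discsOver q D y := by
  refine Subset.antisymm ?_ ?_
  · rintro _ ⟨x, hx, rfl⟩
    obtain ⟨n, hn, hxn⟩ := (mem_discs_iff D).1 hx
    exact mem_iUnion₂.2 ⟨q n, ⟨n, hn, rfl⟩, ⟨x, disc_subset_discsOver q D hn hxn, rfl⟩⟩
  · intro z hz
    obtain ⟨y, -, x, hx, rfl⟩ := mem_iUnion₂.1 hz
    obtain ⟨n, hn, -, hxn⟩ := mem_discsOver_iff.1 hx
    exact ⟨x, (mem_discs_iff D).2 ⟨n, hn, hxn⟩, rfl⟩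

include hinj in
/-- The pinched wedges over distinct points are disjoint. [folklore] -/
theorem disjoint_image_discsOver {y y' : K} (hne : y ≠ y') :
    Disjoint (q '' discsOver q D y) (q '' discsOver q D y') := by
  refine Set.disjoint_left.2 fun z hz hz' ↦ hne ?_
  obtain ⟨x, hx, rfl⟩ := hz
  obtain ⟨x', hx', hxx'⟩ := hz'
  obtain ⟨n, hn, hqn, hxn⟩ := mem_discsOver_iff.1 hx
  obtain ⟨n', hn', hqn', hxn'⟩ := mem_discsOver_iff.1 hx'
  by_cases h : x' = x
  · subst h
    rw [← hqn, ← hqn', D.eq_of_mem_disc_of_mem_disc hn hn' hxn hxn']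
  · obtain ⟨hx'F, hxF⟩ := hinj hxx' h
    rw [← apply_eq_of_mem_discsOver hxF hx, ← apply_eq_of_mem_discsOver hx'F hx', hxx']

/-- The complement of the closed half-discs of the points of `F`. [folklore] -/
def outer (D : DiscSystem E F) : Set N := (⋃ (n : N) (_ : n ∈ F), chartCDisc E n (D.rad n / 2))ᶜ

/-- The outer part is open (finitely many compact closed half-discs removed). [folklore] -/
theorem isOpen_outer [ProperSpace E] [T2Space N] (hF : F.Finite) : IsOpen (outer D) := by
  rw [outer, isOpen_compl_iff]
  exact hF.isClosed_biUnion fun n hn ↦ isClosed_chartCDisc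
    ((D.good hn).mono (half_pos (D.good hn).pos) (half_le_self (D.good hn).pos.le))

/-- The outer part misses `F`. [folklore] -/
theorem disjoint_outer : Disjoint (outer D) F := by
  refine Set.disjoint_left.2 fun x hx hxF ↦ hx ?_
  exact mem_iUnion₂.2 ⟨x, hxF, mem_chartCDisc_self x (half_pos (D.good hxF).pos).le⟩

include hinj in
/-- The outer part is saturated: `q⁻¹(q(outer)) = outer`. [folklore] -/
theorem preimage_image_outer : q ⁻¹' (q '' outer D) = outer D := by
  refine Subset.antisymm (fun x hx ↦ ?_) (subset_preimage_image q _)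
  obtain ⟨a, ha, hax⟩ := hx
  by_cases hax' : a = x
  · exact hax' ▸ ha
  · exact (Set.disjoint_left.1 (disjoint_outer D) ha (hinj hax hax').1).elim

/-- `N = outer ∪ discs`. [folklore] -/
theorem outer_union_discs : outer D ∪ discs D = univ := by
  refine eq_univ_of_forall fun x ↦ ?_
  by_cases hx : x ∈ outer D
  · exact Or.inl hx
  · rw [outer, mem_compl_iff, not_not] at hx
    obtain ⟨n, hn, hxn⟩ := mem_iUnion₂.1 hx
    exact Or.inr ((mem_discs_iff D).2 ⟨n, hn, chartCDisc_subset_chartDisc n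
      (half_lt_self (D.good hn).pos) hxn⟩)

include hinj in
/-- `q` is injective on the outer part. [folklore] -/
theorem injOn_outer : InjOn q (outer D) := fun a ha b _ hab ↦ by
  by_contra hne
  exact Set.disjoint_left.1 (disjoint_outer D) ha (hinj hab hne).1

end CoverLemmas

section HTwo

open CategoryTheory

universe u v

variable {R : Type v} [CommRing R]

/-- The positive-degree cohomology of a contractible space vanishes. [cite: HatcherAT2002, §3.1 p. 201] -/
theorem isZero_singularCohomology_of_contractibleSpace' (X : Type u) [TopologicalSpace X]
    [ContractibleSpace X] {n : ℕ} (hn : n ≠ 0) : Limits.IsZero (singularCohomology R R X n) :=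
  (singularCochainComplex.isZero_singularCohomology_of_subsingleton' (R := R) (M := R)
    (X := PUnit.{u + 1}) hn).of_iso (singularCohomology.isoOfContractible R R X n).symm

/-- A piece `val⁻¹ W` of a subspace `↥B`, `W ⊆ B`, is homeomorphic to `↥W`. [folklore] -/
def preimageValHomeomorph {K : Type u} [TopologicalSpace K] {B W : Set K} (h : W ⊆ B) :
    ↥((Subtype.val : ↥B → K) ⁻¹' W) ≃ₜ ↥W where
  toFun p := ⟨p.1.1, p.2⟩
  invFun w := ⟨⟨w.1, h w.2⟩, w.2⟩
  left_inv _ := rfl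
  right_inv _ := rfl
  continuous_toFun := (continuous_subtype_val.comp continuous_subtype_val).subtype_mk _
  continuous_invFun := (continuous_subtype_val.subtype_mk _).subtype_mk _

/-- The cohomology of a space with a clopen partition into contractible pieces vanishes in
positive degrees. [cite: HatcherAT2002, §3.1 p. 202] -/
theorem isZero_singularCohomology_of_clopenPartition_contractible {X : Type u} [TopologicalSpace X]
    {J : Type*} {P : J → Set X} (hP : IsClopenPartition P) (hc : ∀ j, ContractibleSpace ↥(P j))
    {n : ℕ} (hn : n ≠ 0) : Limits.IsZero (singularCohomology R R X n) := by
  have h0 : ∀ x : singularCohomology R R X n, x = 0 := fun x ↦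
    singularCohomology.eq_zero_of_forall_map_subsetIncl_eq_zero hP fun j ↦
      @Subsingleton.elim _ (ModuleCat.subsingleton_of_isZero
        (isZero_singularCohomology_of_contractibleSpace' (R := R) _ hn)) _ _
  haveI : Subsingleton (singularCohomology R R X n) := subsingleton_of_forall_eq 0 h0
  exact ModuleCat.isZero_of_subsingleton _

/-- A homeomorphism induces bijections on cohomology. [folklore] -/
theorem singularCohomology_map_bijective_of_isHomeomorph {X Y : Type u} [TopologicalSpace X]
    [TopologicalSpace Y] (f : C(X, Y)) (hf : IsHomeomorph f) (n : ℕ) :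
    Function.Bijective (singularCohomology.map R R f n) := by
  have he : (hf.homeomorph f : C(X, Y)) = f := by ext x; rfl
  rw [← he]
  exact (ConcreteCategory.isIso_iff_bijective (singularCohomology.mapIso R R (hf.homeomorph f) n).hom).1
    inferInstance

variable {E : Type*} [NormedAddCommGroup E] [NormedSpace ℝ E] [ProperSpace E]
  {N : Type u} [TopologicalSpace N] [T2Space N] [ChartedSpace E N] {K : Type u} [TopologicalSpace K]

include E in
/-- **A pinch map is injective on `H²`.** Let `q : N → K` be a quotient map from a Hausdorff
space charted on a proper real normed space, injective except on a finite set `F`. Then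
`q* : H²(K; R) → H²(N; R)` is injective: Mayer–Vietoris for the cover of `K` by the outer part
`q(N ∖ half-discs)` (on which `q` is a homeomorphism onto its image) and the pinched wedges
`q(discs)` (contractible, with contractible preimages the discs), via the four-lemma
`subsetCochains.singularCohomology_map_injective_of_cover`. [cite: HatcherAT2002, §3.1 p. 204] -/
theorem singularCohomology_map_injective_two_of_pinch (R : Type v) [CommRing R] (q : C(N, K))
    (hq : IsQuotientMap q) {F : Set N} (hF : F.Finite)
    (hinj : ∀ ⦃a b : N⦄, q a = q b → a ≠ b → a ∈ F ∧ b ∈ F) :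
    Function.Injective (singularCohomology.map R R q 2) := by
  classical
  obtain ⟨D, -⟩ := exists_discSystem (E := E) hF (fun _ ↦ univ) (fun _ _ ↦ univ_mem)
  set A : Set K := q '' outer D with hAdef
  set B : Set K := q '' discs D with hBdef
  have hqA : q ⁻¹' A = outer D := preimage_image_outer hinj D
  have hqB : q ⁻¹' B = discs D := preimage_image_discs hinj D
  have hA : IsOpen A := by rw [← hq.isOpen_preimage, hqA]; exact isOpen_outer D hF
  have hB : IsOpen B := by rw [← hq.isOpen_preimage, hqB]; exact isOpen_discs D
  have hAB : A ∪ B = univ := by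
    refine eq_univ_of_forall fun y ↦ ?_
    obtain ⟨x, rfl⟩ := hq.surjective y
    have hx : x ∈ outer D ∪ discs D := by rw [outer_union_discs]; exact mem_univ x
    exact hx.elim (fun h ↦ Or.inl ⟨x, h, rfl⟩) (fun h ↦ Or.inr ⟨x, h, rfl⟩)
  -- `H²(↥B) = 0`: `↥B` is the disjoint union of the contractible pinched wedges
  have hBz : Limits.IsZero (singularCohomology R R ↥B 2) := by
    let P : ↥(q '' F) → Set ↥B := fun y ↦ Subtype.val ⁻¹' (q '' discsOver q D y.1)
    have hWB : ∀ y : ↥(q '' F), q '' discsOver q D y.1 ⊆ B := by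
      intro y
      rw [hBdef, image_discs_eq D]
      exact subset_iUnion₂ (s := fun (y : K) (_ : y ∈ q '' F) ↦ q '' discsOver q D y) y.1 y.2
    have hP : IsClopenPartition P :=
      { isOpen := fun y ↦ (isOpen_image_discsOver hq hinj D y.1).preimage continuous_subtype_val
        disjoint := fun y y' hne ↦ (disjoint_image_discsOver hinj D
          (fun h ↦ hne (Subtype.ext h))).preimage Subtype.val
        exists_mem := fun b ↦ by
          have hb : b.1 ∈ ⋃ (y : K) (_ : y ∈ q '' F), q '' discsOver q D y := by
            rw [← image_discs_eq D]; exact b.2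
          obtain ⟨y, hy, hby⟩ := mem_iUnion₂.1 hb
          exact ⟨⟨y, hy⟩, hby⟩ }
    refine isZero_singularCohomology_of_clopenPartition_contractible hP (fun y ↦ ?_) two_ne_zero
    obtain ⟨n₀, hn₀, hqn₀⟩ := y.2
    haveI := contractibleSpace_image_discsOver D y.1 hinj hq hn₀ hqn₀
    exact (preimageValHomeomorph (hWB y)).contractibleSpace
  -- `H¹(↥(q⁻¹B)) = 0`: `q⁻¹B` is the disjoint union of the contractible discs
  have hB'z : Limits.IsZero (singularCohomology R R ↥(q ⁻¹' B) 1) := by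
    rw [hqB]
    let P : ↥F → Set ↥(discs D) := fun n ↦ Subtype.val ⁻¹' D.disc n.1
    have hDB : ∀ n : ↥F, D.disc n.1 ⊆ discs D := fun n x hx ↦ (mem_discs_iff D).2 ⟨n.1, n.2, hx⟩
    have hP : IsClopenPartition P :=
      { isOpen := fun n ↦ (isOpen_chartDisc n.1 _).preimage continuous_subtype_val
        disjoint := fun n n' hne ↦ (D.disjoint n.2 n'.2 (fun h ↦ hne (Subtype.ext h))).preimage _
        exists_mem := fun x ↦ by
          obtain ⟨n, hn, hxn⟩ := (mem_discs_iff D).1 x.2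
          exact ⟨⟨n, hn⟩, hxn⟩ }
    refine isZero_singularCohomology_of_clopenPartition_contractible hP (fun n ↦ ?_) one_ne_zero
    haveI := contractibleSpace_chartDisc (D.good n.2)
    exact (preimageValHomeomorph (hDB n)).contractibleSpace
  -- `q` restricts to homeomorphisms over `A` and over `A ∩ B`
  have hhomA : IsHomeomorph (subsetCochains.restrictMap q (subsetCochains.mapsTo_preimage_left q A)) := by
    refine isHomeomorph_iff_isQuotientMap_injective.2 ⟨hq.restrictPreimage_isOpen hA, ?_⟩
    intro a b hab
    have ha : a.1 ∈ outer D := hqA.le a.2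
    have hb : b.1 ∈ outer D := hqA.le b.2
    exact Subtype.ext (injOn_outer hinj D ha hb (congrArg Subtype.val hab))
  have hhomAB : IsHomeomorph
      (subsetCochains.restrictMap q (subsetCochains.mapsTo_preimage_inter q A B)) := by
    refine isHomeomorph_iff_isQuotientMap_injective.2 ⟨hq.restrictPreimage_isOpen (hA.inter hB), ?_⟩
    intro a b hab
    have ha : a.1 ∈ outer D := hqA.le a.2.1
    have hb : b.1 ∈ outer D := hqA.le b.2.1
    exact Subtype.ext (injOn_outer hinj D ha hb (congrArg Subtype.val hab))
  exact subsetCochains.singularCohomology_map_injective_of_cover q hA hB hAB hBz hB'z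
    (singularCohomology_map_bijective_of_isHomeomorph _ hhomA 1).2
    (singularCohomology_map_bijective_of_isHomeomorph _ hhomAB 1).1
    (singularCohomology_map_bijective_of_isHomeomorph _ hhomA 2).1

end HTwo

end Pinch

end Literature.AlgebraicTopology.SingularHomology

end
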